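import Literature.NumberTheory.LFunctions.UnconditionalPairCorrelation
import Literature.NumberTheory.LFunctions.WeilZeroSum
import Mathlib.Analysis.SpecialFunctions.ImproperIntegrals
import Mathlib.MeasureTheory.Integral.IntegralEqImproper
import Mathlib.Analysis.SpecialFunctions.Complex.LogDeriv
import HarnessLib

/-!
RH-FREE — «nothing here bears on the truth of RH».

# The unconditional Montgomery pair sum as a mean square (Baluyot–Goldston–Suriajaya–
# Turnage-Butterbaugh, Acta Arith. 214 (2024), Lemma 3): complex Cauchy kernels, the exact
# `L²` identity, and the qualitative clauses of the unconditional Montgomery theorem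

RH-FREE (every statement here is an unconditional theorem about the zeros of `ζ`, real parts kept);
«nothing here bears on the truth of RH». Topic `Literature/NumberTheory/LFunctions` (namespace
`Literature.NumberTheory.LFunctions`, paper objects in `BGSTB2024` as in
`UnconditionalPairCorrelation.lean`). PROOF LAYER: no named facts; the only `def`s are the two
objects of the printed proof (`BGSTB2024.kernel`, `BGSTB2024.zeroKernelSum`) with bodies.
Status note (no endorsement): the source is a refereed journal paper (Acta Arith. 214 (2024)
357–376); its Theorem 1 error term was later corrected by the authors (arXiv:2501.14545 §2, see the
ERRATUM docstrings of `UnconditionalPairCorrelation.lean`); Lemma 3, formalised here, is unaffected.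

This is the first of the proof files for the discharge of the unconditional Montgomery theorem
`Literature.NumberTheory.LFunctions.baluyotEtAl2025_montgomeryTheorem` (the corrected Theorem 1 over
the dyadic window). It supplies the calculus input that the tree has so far only ON the critical
line (`MontgomeryCauchyKernel.lean`: `∫_ℝ dt/((1+(t−a)²)(1+(t−b)²)) = 2π/(4+(a−b)²)` for REAL
`a, b`), namely the same convolution identity for the complex-shifted kernels that appear when the
real parts `β = 1/2 + δ` of the zeros are kept:

* §1 `BGSTB2024.integral_inv_sub_mul_inv_sub` — **two-pole integrals over `ℝ`**: for `z, w ∉ ℝ`,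
  `z ≠ w`, `∫_ℝ dt/((t−z)(t−w)) = πi(σ(w) − σ(z))/(z − w)` with `σ = −1` on the upper and `+1` on
  the lower half plane, i.e. `2πi/(z−w)` for `Im z > 0 > Im w` and `0` when `z, w` lie in the same
  half plane (also for `z = w`); by the primitive `(log(t−z) − log(t−w))/(z−w)` and the one-sided
  limits of `Complex.log` at `−1` (`integral_of_hasDerivAt_of_tendsto`).
* §2 `BGSTB2024.kernel a t = 1/(1 − (a − it)²)` — for `a = ρ − 1/2` this is the printed
  `1/(1 − (ρ − (1/2+it))²)` of Lemma 3 / the `1/(1 + ((t−γ)+iδ)²)` of (lem3eq2); ON the line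
  (`a = iγ`) it is Montgomery's `1/(1+(t−γ)²)`. **`BGSTB2024.integral_kernel_mul_conj_kernel`**:
  for `|Re a|, |Re b| < 1`, `∫_ℝ K(a,t) conj(K(b,t)) dt = (π/2) w(a + b̄)`, `w(u) = 4/(4−u²)`
  (= the source's display (integral): `∫ dt/((1+t²)(1+(t+a)²)) = 2π/(4+a²)`, `|Im a| < 1`,
  "easily obtained by residues or Mathematica" — here by partial fractions into four two-pole terms).
* §3 `BGSTB2024.integral_zeroKernelSum_mul_conj` — **Lemma 3 for a finite set of zeros closed under
  `ρ ↦ 1 − ρ̄`** (multiplicities as weights): `∫_ℝ |Σ_{ρ∈Z} m(ρ) x^{ρ−1/2} K(ρ−1/2,t)|² dt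
  = (π/2) Σ_{ρ,ρ'∈Z} m(ρ)m(ρ') x^{ρ−ρ'} w(ρ−ρ')`, via `x^{ρ−1/2} conj(x^{ρ'−1/2}) = x^{ρ+ρ̄'−1}`
  and the reindexing `ρ' ↦ 1 − ρ̄'` (which fixes ordinates and multiplicities,
  `riemannZetaZeroOrder_one_sub_conj`), exactly as printed ((F(x,T)2): "`F(x,T) = Σ x^{ρ+ρ̄'−1}
  w(ρ+ρ̄'−1)`").
* §4 **Lemma 3** `baluyotEtAl2024_lemma3` (`F(x,T) = (2/π)∫_ℝ |Σ_{0<γ≤T} x^{ρ−1/2}/(1−(ρ−(1/2+it))²)|² dt`,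
  zeros with multiplicity, every `x > 0`, every `T`) and its dyadic twin
  `BGSTB2024.pairSumDyadic_eq_integral` for the window `T < γ ≤ 2T` of the 2025 correction.
* §5 **The qualitative clauses, PROVED**: `baluyotEtAl2025_montgomeryTheorem_qualitative` — the first
  conjunct of `baluyotEtAl2025_montgomeryTheorem` verbatim ("for `x ≥ 1` and `T ≥ 3`, `𝓕(x,T) ≥ 0`
  [real with non-negative real part] and `𝓕(x,T) = 𝓕(1/x,T)`"; in fact for all `x > 0` and all
  `T`), and `baluyotEtAl2024_theorem1_qualitative` ("`F(α)` is real, even, and nonnegative", `T ≥ 3`;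
  the first conjunct of the 2024 Theorem 1 as typed — that typed fact is deprecated for its RETRACTED
  error term only, so it is not named in code here).

What is NOT here: the asymptotic clause of (MT) (Lemmas 1, 4 and the Goldston–Montgomery mean
values; sibling files `UnconditionalPairCorrelation{ExplicitFormula,ZeroSide,Proofs}.lean`).

## References

* [BaluyotEtAl2024] S. A. C. Baluyot, D. A. Goldston, A. I. Suriajaya, C. L. Turnage-Butterbaugh,
  *An unconditional Montgomery theorem for pair correlation of zeros of the Riemann zeta-function*,
  Acta Arith. 214 (2024) 357–376 = arXiv:2306.04799, §2: (F(x,T)2), Lemma 3 with its proof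
  (displays (integral), (lem3eq), (lem3eq2)); held text `paper:arxiv-2306.04799` p0004.
* [BaluyotEtAl2025] the same authors, arXiv:2501.14545, §2 "Montgomery Theorem (MT)" (the dyadic
  window `T < γ,γ' ≤ 2T` and the clauses `𝓕 ≥ 0`, `𝓕(x,T) = 𝓕(1/x,T)`).
* [Goldston2005] D. A. Goldston, *Notes on pair correlation of zeros and prime numbers*, (4.1) (the
  on-line case, tree: `Montgomery.integral_cauchyKernel_mul_cauchyKernel`).
-/

noncomputable section

open Complex Filter Set MeasureTheory
open scoped Real Topology ComplexConjugate

namespace Literature.NumberTheory.LFunctions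

namespace BGSTB2024

/-! ## §1. Two-pole integrals over the real line -/

/-- `t − z ≠ 0` for real `t` when `z ∉ ℝ`. [folklore] -/
private theorem ofReal_sub_ne_zero {z : ℂ} (hz : z.im ≠ 0) (t : ℝ) : (t : ℂ) - z ≠ 0 := by
  intro h
  have := congrArg Complex.im h
  simp at this
  exact hz (by linarith)

/-- `t − z` lies in the slit plane for real `t` when `z ∉ ℝ`. [folklore] -/
private theorem ofReal_sub_mem_slitPlane {z : ℂ} (hz : z.im ≠ 0) (t : ℝ) : (t : ℂ) - z ∈ slitPlane := by
  rw [mem_slitPlane_iff]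
  right
  simpa using hz

/-- `d/dt log(t − z) = 1/(t − z)` along the real line, `z ∉ ℝ`. [folklore] -/
private theorem hasDerivAt_log_ofReal_sub {z : ℂ} (hz : z.im ≠ 0) (t : ℝ) :
    HasDerivAt (fun t : ℝ ↦ Complex.log ((t : ℂ) - z)) (1 / ((t : ℂ) - z)) t := by
  have h1 : HasDerivAt (fun t : ℝ ↦ (t : ℂ) - z) 1 t := by
    simpa using ((hasDerivAt_id t).ofReal_comp).sub_const z
  have h2 := h1.clog_real (ofReal_sub_mem_slitPlane hz t)
  simpa using h2

/-- `‖t − z‖² ≥ min(1, (Im z)²)·(1 + (t − Re z)²)` for real `t`. [folklore] -/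
private theorem min_mul_le_norm_ofReal_sub_sq (z : ℂ) (t : ℝ) :
    min 1 (z.im ^ 2) * (1 + (t - z.re) ^ 2) ≤ ‖(t : ℂ) - z‖ ^ 2 := by
  have e : ‖(t : ℂ) - z‖ ^ 2 = (t - z.re) ^ 2 + z.im ^ 2 := by
    rw [← Complex.normSq_eq_norm_sq, Complex.normSq_apply]
    simp; ring
  rw [e]
  have h1 : min 1 (z.im ^ 2) ≤ 1 := min_le_left _ _
  have h2 : min 1 (z.im ^ 2) ≤ z.im ^ 2 := min_le_right _ _
  have h3 : 0 ≤ min 1 (z.im ^ 2) := le_min zero_le_one (sq_nonneg _)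
  nlinarith [sq_nonneg (t - z.re)]

/-- `‖1/(t − z)‖² ≤ (min(1,(Im z)²))⁻¹/(1 + (t − Re z)²)` for `z ∉ ℝ`. [folklore] -/
private theorem norm_inv_ofReal_sub_sq_le {z : ℂ} (hz : z.im ≠ 0) (t : ℝ) :
    ‖1 / ((t : ℂ) - z)‖ ^ 2 ≤ (min 1 (z.im ^ 2))⁻¹ * (1 + (t - z.re) ^ 2)⁻¹ := by
  have hc : 0 < min 1 (z.im ^ 2) := lt_min one_pos (by positivity)
  have hq : 0 < 1 + (t - z.re) ^ 2 := by positivity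
  have h := min_mul_le_norm_ofReal_sub_sq z t
  have hn : 0 < ‖(t : ℂ) - z‖ := norm_pos_iff.2 (ofReal_sub_ne_zero hz t)
  rw [norm_div, norm_one, div_pow, one_pow, ← mul_inv, one_div]
  exact inv_anti₀ (by positivity) h

/-- The two-pole integrand `1/((t − z)(t − w))` is integrable on `ℝ` for `z, w ∉ ℝ`
(`2|ab| ≤ a² + b²` and `1/‖t − z‖² ≪ 1/(1 + (t − Re z)²)`). [cite: BaluyotEtAl2024, Lemma 3 (proof, display (integral): «by residues»)] -/
theorem integrable_inv_sub_mul_inv_sub {z w : ℂ} (hz : z.im ≠ 0) (hw : w.im ≠ 0) :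
    Integrable fun t : ℝ ↦ 1 / (((t : ℂ) - z) * ((t : ℂ) - w)) := by
  set cz : ℝ := (min 1 (z.im ^ 2))⁻¹ with hcz
  set cw : ℝ := (min 1 (w.im ^ 2))⁻¹ with hcw
  have hint : Integrable fun t : ℝ ↦
      (cz * (1 + (t - z.re) ^ 2)⁻¹ + cw * (1 + (t - w.re) ^ 2)⁻¹) / 2 := by
    refine Integrable.div_const (Integrable.add ?_ ?_) 2
    · exact (integrable_inv_one_add_sq.comp_sub_right z.re).const_mul cz
    · exact (integrable_inv_one_add_sq.comp_sub_right w.re).const_mul cw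
  refine hint.mono' ?_ (Eventually.of_forall fun t ↦ ?_)
  · refine Continuous.aestronglyMeasurable ?_
    exact continuous_const.div (by fun_prop)
      fun t ↦ mul_ne_zero (ofReal_sub_ne_zero hz t) (ofReal_sub_ne_zero hw t)
  · have e : (1 : ℂ) / (((t : ℂ) - z) * ((t : ℂ) - w)) = (1 / ((t : ℂ) - z)) * (1 / ((t : ℂ) - w)) := by
      rw [one_div_mul_one_div]
    rw [e, norm_mul]
    have h1 := norm_inv_ofReal_sub_sq_le hz t
    have h2 := norm_inv_ofReal_sub_sq_le hw t
    nlinarith [sq_nonneg (‖1 / ((t : ℂ) - z)‖ - ‖1 / ((t : ℂ) - w)‖), norm_nonneg (1 / ((t : ℂ) - z)),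
      norm_nonneg (1 / ((t : ℂ) - w))]

/-- `log(t − z) − log t → 0` as `t → +∞` (`z` fixed). [folklore] -/
private theorem tendsto_log_ofReal_sub_sub_log_atTop (z : ℂ) :
    Tendsto (fun t : ℝ ↦ Complex.log ((t : ℂ) - z) - (Real.log t : ℂ)) atTop (𝓝 0) := by
  -- `z/t → 0`
  have hzt : Tendsto (fun t : ℝ ↦ z / (t : ℂ)) atTop (𝓝 0) := by
    rw [tendsto_zero_iff_norm_tendsto_zero]
    have h : Tendsto (fun t : ℝ ↦ ‖z‖ * t⁻¹) atTop (𝓝 (‖z‖ * 0)) :=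
      tendsto_inv_atTop_zero.const_mul _
    rw [mul_zero] at h
    refine h.congr' ?_
    filter_upwards [eventually_gt_atTop 0] with t ht
    rw [norm_div, Complex.norm_real, Real.norm_eq_abs, abs_of_pos ht, div_eq_mul_inv]
  have h1 : Tendsto (fun t : ℝ ↦ 1 - z / (t : ℂ)) atTop (𝓝 1) := by
    simpa using (tendsto_const_nhds (x := (1 : ℂ))).sub hzt
  have hlog : Tendsto (fun t : ℝ ↦ Complex.log (1 - z / (t : ℂ))) atTop (𝓝 0) := by
    have := ((continuousAt_clog (by simp : (1 : ℂ) ∈ slitPlane)).tendsto).comp h1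
    simpa [Function.comp_def] using this
  refine hlog.congr' ?_
  filter_upwards [eventually_gt_atTop ‖z‖, eventually_gt_atTop 0] with t ht ht0
  have hne : 1 - z / (t : ℂ) ≠ 0 := by
    intro h
    have : z / (t : ℂ) = 1 := by linear_combination -h
    have hn := congrArg norm this
    rw [norm_div, Complex.norm_real, Real.norm_eq_abs, abs_of_pos ht0, norm_one,
      div_eq_one_iff_eq (ne_of_gt (lt_of_le_of_lt (norm_nonneg z) ht))] at hn
    linarith
  have htne : (t : ℂ) ≠ 0 := by exact_mod_cast ht0.ne'
  have e : ((t : ℂ) - z) = (t : ℂ) * (1 - z / (t : ℂ)) := by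
    rw [mul_sub, mul_one, mul_div_cancel₀ _ htne]
  rw [e, Complex.log_ofReal_mul ht0 hne]
  ring

/-- The sign `σ(z)`: `−1` on the upper half plane, `+1` otherwise (used on the lower half plane):
`log(t − z) − log|t| → σ(z)·πi` as `t → −∞`. [folklore] -/
def halfPlaneSign (z : ℂ) : ℂ := if 0 < z.im then -1 else 1

/-- `log(t − z) − log(−t) → σ(z) πi` as `t → −∞`, `z ∉ ℝ`: the argument of `t − z` tends to `∓π`
according as `Im z ≷ 0` (one-sided continuity of `Complex.log` at `−1`). [folklore] -/
private theorem tendsto_log_ofReal_sub_sub_log_atBot {z : ℂ} (hz : z.im ≠ 0) :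
    Tendsto (fun t : ℝ ↦ Complex.log ((t : ℂ) - z) - (Real.log (-t) : ℂ)) atBot
      (𝓝 (halfPlaneSign z * (π * I))) := by
  -- `w(t) = -1 - z/(-t) → -1`
  have hzt : Tendsto (fun t : ℝ ↦ z / ((-t : ℝ) : ℂ)) atBot (𝓝 0) := by
    rw [tendsto_zero_iff_norm_tendsto_zero]
    have h : Tendsto (fun t : ℝ ↦ ‖z‖ * (-t)⁻¹) atBot (𝓝 (‖z‖ * 0)) :=
      (tendsto_inv_atTop_zero.comp tendsto_neg_atBot_atTop).const_mul _
    rw [mul_zero] at h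
    refine h.congr' ?_
    filter_upwards [eventually_lt_atBot 0] with t ht
    rw [norm_div, Complex.norm_real, Real.norm_eq_abs, abs_of_pos (by linarith), div_eq_mul_inv]
  have hw : Tendsto (fun t : ℝ ↦ -1 - z / ((-t : ℝ) : ℂ)) atBot (𝓝 (-1)) := by
    simpa using (tendsto_const_nhds (x := (-1 : ℂ))).sub hzt
  have him : ∀ t : ℝ, t < 0 → (-1 - z / ((-t : ℝ) : ℂ)).im = z.im / t := by
    intro t ht
    have : ((-t : ℝ) : ℂ) = -(t : ℂ) := by push_cast; ring
    rw [this, div_neg, sub_neg_eq_add, add_im, neg_im, one_im, neg_zero, zero_add, div_ofReal_im]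
  have hne : ∀ t : ℝ, t < 0 → -1 - z / ((-t : ℝ) : ℂ) ≠ 0 := by
    intro t ht h
    have := congrArg Complex.im h
    rw [him t ht, zero_im, div_eq_zero_iff] at this
    rcases this with h1 | h1
    · exact hz h1
    · exact ht.ne h1
  -- the identity `log(t - z) - log(-t) = log(-1 - z/(-t))` for `t < 0`
  have hid : ∀ᶠ t : ℝ in atBot, Complex.log ((t : ℂ) - z) - (Real.log (-t) : ℂ) =
      Complex.log (-1 - z / ((-t : ℝ) : ℂ)) := by
    filter_upwards [eventually_lt_atBot 0] with t ht
    have ht' : 0 < -t := by linarith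
    have e : ((t : ℂ) - z) = ((-t : ℝ) : ℂ) * (-1 - z / ((-t : ℝ) : ℂ)) := by
      have hne' : ((-t : ℝ) : ℂ) ≠ 0 := by exact_mod_cast ht'.ne'
      field_simp
      push_cast
      ring
    rw [e, Complex.log_ofReal_mul ht' (hne t ht)]
    ring
  rw [halfPlaneSign]
  split_ifs with hpos
  · -- `Im z > 0`: `w(t)` approaches `-1` from the lower half plane
    have hlim := tendsto_log_nhdsWithin_im_neg_of_re_neg_of_im_zero
      (z := (-1 : ℂ)) (by simp) (by simp)
    have hwin : Tendsto (fun t : ℝ ↦ -1 - z / ((-t : ℝ) : ℂ)) atBot (𝓝[{w : ℂ | w.im < 0}] (-1)) := by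
      refine tendsto_nhdsWithin_iff.2 ⟨hw, ?_⟩
      filter_upwards [eventually_lt_atBot 0] with t ht
      simp only [him t ht]
      exact div_neg_of_pos_of_neg hpos ht
    have h := hlim.comp hwin
    simp only [norm_neg, norm_one, Real.log_one, ofReal_zero, zero_sub] at h
    refine (h.congr' (hid.mono fun t ht ↦ ?_)).congr (fun _ ↦ rfl) |>.trans ?_
    · simp only [Function.comp, ht]
    · simp
  · -- `Im z < 0`: `w(t)` approaches `-1` from the (closed) upper half plane
    have hneg : z.im < 0 := lt_of_le_of_ne (not_lt.1 hpos) hz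
    have hlim := tendsto_log_nhdsWithin_im_nonneg_of_re_neg_of_im_zero
      (z := (-1 : ℂ)) (by simp) (by simp)
    have hwin : Tendsto (fun t : ℝ ↦ -1 - z / ((-t : ℝ) : ℂ)) atBot (𝓝[{w : ℂ | 0 ≤ w.im}] (-1)) := by
      refine tendsto_nhdsWithin_iff.2 ⟨hw, ?_⟩
      filter_upwards [eventually_lt_atBot 0] with t ht
      simp only [him t ht]
      exact (div_pos_of_neg_of_neg hneg ht).le
    have h := hlim.comp hwin
    simp only [norm_neg, norm_one, Real.log_one, ofReal_zero, zero_add] at h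
    refine (h.congr' (hid.mono fun t ht ↦ ?_)).congr (fun _ ↦ rfl) |>.trans ?_
    · simp only [Function.comp, ht]
    · simp

/-- **Two-pole integral over `ℝ`**: for `z, w ∉ ℝ`, `z ≠ w`,
`∫_ℝ dt/((t − z)(t − w)) = (σ(w) − σ(z)) πi/(z − w)`, `σ = −1` on the upper half plane and `+1`
on the lower one; i.e. `2πi × (residue in the upper half plane)`: `2πi/(z−w)` if `Im z > 0 > Im w`,
`0` if `z, w` lie in the same half plane. (Primitive `(log(t−z) − log(t−w))/(z−w)`.) [cite: BaluyotEtAl2024, Lemma 3 (proof, display (integral): «by residues»)] -/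
theorem integral_inv_sub_mul_inv_sub {z w : ℂ} (hz : z.im ≠ 0) (hw : w.im ≠ 0) (hzw : z ≠ w) :
    ∫ t : ℝ, 1 / (((t : ℂ) - z) * ((t : ℂ) - w)) =
      (halfPlaneSign w - halfPlaneSign z) * (π * I) / (z - w) := by
  have hzw' : z - w ≠ 0 := sub_ne_zero.2 hzw
  -- the primitive
  have hderiv : ∀ t : ℝ, HasDerivAt
      (fun t : ℝ ↦ (Complex.log ((t : ℂ) - z) - Complex.log ((t : ℂ) - w)) / (z - w))
      (1 / (((t : ℂ) - z) * ((t : ℂ) - w))) t := by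
    intro t
    have h := ((hasDerivAt_log_ofReal_sub hz t).sub (hasDerivAt_log_ofReal_sub hw t)).div_const (z - w)
    refine h.congr_deriv ?_
    have h1 := ofReal_sub_ne_zero hz t
    have h2 := ofReal_sub_ne_zero hw t
    field_simp
    ring
  -- limits at `±∞`
  have htop : Tendsto (fun t : ℝ ↦ (Complex.log ((t : ℂ) - z) - Complex.log ((t : ℂ) - w)) / (z - w))
      atTop (𝓝 ((0 - 0) / (z - w))) := by
    refine (((tendsto_log_ofReal_sub_sub_log_atTop z).sub
      (tendsto_log_ofReal_sub_sub_log_atTop w)).div_const (z - w)).congr fun t ↦ ?_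
    ring
  have hbot : Tendsto (fun t : ℝ ↦ (Complex.log ((t : ℂ) - z) - Complex.log ((t : ℂ) - w)) / (z - w))
      atBot (𝓝 ((halfPlaneSign z * (π * I) - halfPlaneSign w * (π * I)) / (z - w))) := by
    refine (((tendsto_log_ofReal_sub_sub_log_atBot hz).sub
      (tendsto_log_ofReal_sub_sub_log_atBot hw)).div_const (z - w)).congr fun t ↦ ?_
    ring
  rw [integral_of_hasDerivAt_of_tendsto hderiv (integrable_inv_sub_mul_inv_sub hz hw) hbot htop]
  field_simp
  ring

/-- The double pole: `∫_ℝ dt/(t − z)² = 0` for `z ∉ ℝ` (primitive `−1/(t − z)`). [cite: BaluyotEtAl2024, Lemma 3 (proof, display (integral): «by residues»)] -/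
theorem integral_inv_sub_sq {z : ℂ} (hz : z.im ≠ 0) :
    ∫ t : ℝ, 1 / (((t : ℂ) - z) * ((t : ℂ) - z)) = 0 := by
  have hderiv : ∀ t : ℝ, HasDerivAt (fun t : ℝ ↦ -(1 / ((t : ℂ) - z)))
      (1 / (((t : ℂ) - z) * ((t : ℂ) - z))) t := by
    intro t
    have h1 : HasDerivAt (fun t : ℝ ↦ (t : ℂ) - z) 1 t := by
      simpa using ((hasDerivAt_id t).ofReal_comp).sub_const z
    have h := (h1.inv (ofReal_sub_ne_zero hz t)).neg
    refine HasDerivAt.congr_deriv (h.congr_of_eventuallyEq (Eventually.of_forall fun s ↦ by simp)) ?_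
    field_simp
  -- `1/(t - z) → 0` at `±∞`
  have hlim : ∀ l : Filter ℝ, Tendsto (fun t : ℝ ↦ ‖(t : ℂ)‖) l atTop →
      Tendsto (fun t : ℝ ↦ -(1 / ((t : ℂ) - z))) l (𝓝 0) := by
    intro l hl
    rw [tendsto_zero_iff_norm_tendsto_zero]
    have h1 : Tendsto (fun t : ℝ ↦ ‖(t : ℂ) - z‖) l atTop := by
      refine tendsto_atTop_mono (fun t ↦ norm_sub_norm_le _ _) ?_
      simpa [sub_eq_add_neg] using tendsto_atTop_add_const_right l (-‖z‖) hl
    refine h1.inv_tendsto_atTop.congr fun t ↦ ?_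
    simp [norm_neg]
  have hn : ∀ t : ℝ, ‖(t : ℂ)‖ = |t| := fun t ↦ by simp
  have htop : Tendsto (fun t : ℝ ↦ -(1 / ((t : ℂ) - z))) atTop (𝓝 0) :=
    hlim atTop ((tendsto_abs_atTop_atTop).congr fun t ↦ (hn t).symm)
  have hbot : Tendsto (fun t : ℝ ↦ -(1 / ((t : ℂ) - z))) atBot (𝓝 0) :=
    hlim atBot ((tendsto_abs_atBot_atTop).congr fun t ↦ (hn t).symm)
  rw [integral_of_hasDerivAt_of_tendsto hderiv (integrable_inv_sub_mul_inv_sub hz hz) hbot htop,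
    sub_zero]

/-- Corollary: **opposite half planes** — for `Im z > 0 > Im w`,
`∫_ℝ dt/((t − z)(t − w)) = 2πi/(z − w)` (the residue at the upper pole). [cite: BaluyotEtAl2024, Lemma 3 (proof, display (integral): «by residues»)] -/
theorem integral_inv_sub_mul_inv_sub_of_im_pos_of_im_neg {z w : ℂ} (hz : 0 < z.im) (hw : w.im < 0) :
    ∫ t : ℝ, 1 / (((t : ℂ) - z) * ((t : ℂ) - w)) = 2 * π * I / (z - w) := by
  have hzw : z ≠ w := fun h ↦ by rw [h] at hz; exact lt_asymm hz hw
  rw [integral_inv_sub_mul_inv_sub hz.ne' hw.ne hzw, halfPlaneSign, halfPlaneSign, if_pos hz,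
    if_neg (not_lt.2 hw.le)]
  ring

/-- Corollary: **lower pole first** — for `Im z < 0 < Im w`,
`∫_ℝ dt/((t − z)(t − w)) = 2πi/(w − z)`. [cite: BaluyotEtAl2024, Lemma 3 (proof, display (integral): «by residues»)] -/
theorem integral_inv_sub_mul_inv_sub_of_im_neg_of_im_pos {z w : ℂ} (hz : z.im < 0) (hw : 0 < w.im) :
    ∫ t : ℝ, 1 / (((t : ℂ) - z) * ((t : ℂ) - w)) = 2 * π * I / (w - z) := by
  have h := integral_inv_sub_mul_inv_sub_of_im_pos_of_im_neg hw hz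
  rw [← h]
  congr 1
  funext t
  rw [mul_comm]

/-- Corollary: **both poles in the upper half plane** — `∫_ℝ dt/((t − z)(t − w)) = 0`
(also for `z = w`). [cite: BaluyotEtAl2024, Lemma 3 (proof, display (integral): «by residues»)] -/
theorem integral_inv_sub_mul_inv_sub_of_im_pos {z w : ℂ} (hz : 0 < z.im) (hw : 0 < w.im) :
    ∫ t : ℝ, 1 / (((t : ℂ) - z) * ((t : ℂ) - w)) = 0 := by
  rcases eq_or_ne z w with rfl | hzw
  · exact integral_inv_sub_sq hz.ne'
  rw [integral_inv_sub_mul_inv_sub hz.ne' hw.ne' hzw, halfPlaneSign, halfPlaneSign, if_pos hz,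
    if_pos hw]
  ring

/-- Corollary: **both poles in the lower half plane** — `∫_ℝ dt/((t − z)(t − w)) = 0`
(also for `z = w`). [cite: BaluyotEtAl2024, Lemma 3 (proof, display (integral): «by residues»)] -/
theorem integral_inv_sub_mul_inv_sub_of_im_neg {z w : ℂ} (hz : z.im < 0) (hw : w.im < 0) :
    ∫ t : ℝ, 1 / (((t : ℂ) - z) * ((t : ℂ) - w)) = 0 := by
  rcases eq_or_ne z w with rfl | hzw
  · exact integral_inv_sub_sq hz.ne
  rw [integral_inv_sub_mul_inv_sub hz.ne hw.ne hzw, halfPlaneSign, halfPlaneSign,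
    if_neg (not_lt.2 hz.le), if_neg (not_lt.2 hw.le)]
  ring

/-! ## §2. The complex-shifted Cauchy kernel and its convolution identity -/

/-- **`K(a,t) = 1/(1 − (a − it)²)`** — for `a = ρ − 1/2` the kernel `1/(1 − (ρ − (1/2+it))²)` of
BGST 2024, Lemma 3 (lem3eq); with `ρ = 1/2 + δ + iγ` it is `1/(1 + ((t−γ)+iδ)²)` (lem3eq2), and on
the critical line (`a = iγ`) Montgomery's `1/(1+(t−γ)²)`. It is the kernel `x^{−ρ} r(ρ)/2` of the
explicit formula (`r(s) = x^s(1/(s−s₁) − 1/(s−s₂))`, `s₁ = −1/2+it`, `s₂ = 3/2+it`, of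
`MontgomeryExplicitFormulaContour.lean`): `1/(ρ−s₁) − 1/(ρ−s₂) = 2 K(ρ−1/2, t)`.
[cite: BaluyotEtAl2024, Lemma 3 (lem3eq)] -/
def kernel (a : ℂ) (t : ℝ) : ℂ := 1 / (1 - (a - t * I) ^ 2)

/-- The two linear factors: `1 − (a − it)² = (1 − a + it)(1 + a − it)`. [cite: BaluyotEtAl2024, Lemma 3 (proof, (lem3eq) ⟶ (lem3eq2))] -/
theorem one_sub_sq_eq (a : ℂ) (t : ℝ) :
    1 - (a - t * I) ^ 2 = (1 - a + t * I) * (1 + a - t * I) := by ring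

/-- `1 − a + it ≠ 0` when `Re a < 1`. [cite: BaluyotEtAl2024, Lemma 3 (proof)] -/
theorem one_sub_add_ne_zero {a : ℂ} (ha : a.re < 1) (t : ℝ) : 1 - a + t * I ≠ 0 := by
  intro h; have := congrArg Complex.re h; simp at this; linarith

/-- `1 + a − it ≠ 0` when `−1 < Re a`. [cite: BaluyotEtAl2024, Lemma 3 (proof)] -/
theorem one_add_sub_ne_zero {a : ℂ} (ha : -1 < a.re) (t : ℝ) : 1 + a - t * I ≠ 0 := by
  intro h; have := congrArg Complex.re h; simp at this; linarith

/-- The kernel never has a vanishing denominator when `|Re a| < 1`. [cite: BaluyotEtAl2024, Lemma 3 (proof)] -/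
theorem one_sub_sq_ne_zero {a : ℂ} (ha : |a.re| < 1) (t : ℝ) : 1 - (a - t * I) ^ 2 ≠ 0 := by
  rw [one_sub_sq_eq]
  exact mul_ne_zero (one_sub_add_ne_zero (abs_lt.1 ha).2 t) (one_add_sub_ne_zero (abs_lt.1 ha).1 t)

/-- Partial fractions: `K(a,t) = ½ (1/(1 − a + it) + 1/(1 + a − it))` for `|Re a| < 1`.
[cite: BaluyotEtAl2024, Lemma 3 (proof, display (integral))] -/
theorem kernel_eq_half_add {a : ℂ} (ha : |a.re| < 1) (t : ℝ) :
    kernel a t = (1 / 2) * (1 / (1 - a + t * I) + 1 / (1 + a - t * I)) := by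
  have h1 := one_sub_add_ne_zero (abs_lt.1 ha).2 t
  have h2 := one_add_sub_ne_zero (abs_lt.1 ha).1 t
  rw [kernel, one_sub_sq_eq]
  field_simp
  ring

/-- On the critical line the kernel is Montgomery's: `K(iγ, t) = 1/(1 + (t − γ)²)`. [cite: BaluyotEtAl2024, §1 («if RH holds then (1.2) agrees with (1.1)»)] -/
theorem kernel_mul_I (γ t : ℝ) : kernel (γ * I) t = 1 / ((1 + (t - γ) ^ 2 : ℝ) : ℂ) := by
  rw [kernel]
  congr 1
  have : ((γ : ℂ) * I - t * I) ^ 2 = -(((t : ℂ) - γ) ^ 2) := by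
    rw [show (γ : ℂ) * I - t * I = ((γ : ℂ) - t) * I by ring, mul_pow, I_sq]; ring
  rw [this]; push_cast; ring

/-- Conjugation: `conj K(b,t) = K(b̄, −t)` (`t` real). [cite: BaluyotEtAl2024, Lemma 3 (proof)] -/
theorem conj_kernel (b : ℂ) (t : ℝ) : conj (kernel b t) = kernel (conj b) (-t) := by
  simp only [kernel, map_div₀, map_one, map_sub, map_pow, map_mul, conj_ofReal, conj_I]
  congr 2
  push_cast
  ring

/-- The algebra of the four partial fractions (atoms `q₁,…,q₄ ≠ 0`):
`(½(1/(iq₁) + 1/(−iq₂)))·(½(1/(−iq₃) + 1/(iq₄))) = ¼(1/(q₁q₃) − 1/(q₁q₄) − 1/(q₂q₃) + 1/(q₂q₄))`.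
[folklore] -/
private theorem half_add_mul_half_add_eq {q₁ q₂ q₃ q₄ : ℂ} (h₁ : q₁ ≠ 0) (h₂ : q₂ ≠ 0) (h₃ : q₃ ≠ 0)
    (h₄ : q₄ ≠ 0) :
    (1 / 2 * (1 / (I * q₁) + 1 / (-I * q₂))) * (1 / 2 * (1 / (-I * q₃) + 1 / (I * q₄))) =
      (1 / 4) * (1 / (q₁ * q₃) - 1 / (q₁ * q₄) - 1 / (q₂ * q₃) + 1 / (q₂ * q₄)) := by
  have hI : (I : ℂ) ≠ 0 := I_ne_zero
  have hI' : (-I : ℂ) ≠ 0 := neg_ne_zero.2 I_ne_zero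
  field_simp
  ring_nf
  rw [I_sq]
  ring

/-- **The product of two kernels in partial fractions** (four two-pole terms): for `|Re a|, |Re b| < 1`,
with the poles `t₁ = i(1−a)` (upper half plane), `t₂ = −i(1+a)` (lower) of `K(a,·)` and
`t₃ = −i(1−b̄)` (lower), `t₄ = i(1+b̄)` (upper) of `conj K(b,·)`,
`K(a,t)·conj K(b,t) = ¼ [1/((t−t₁)(t−t₃)) − 1/((t−t₁)(t−t₄)) − 1/((t−t₂)(t−t₃)) + 1/((t−t₂)(t−t₄))]`.
[cite: BaluyotEtAl2024, Lemma 3 (proof, display (integral))] -/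
theorem kernel_mul_conj_kernel_eq {a b : ℂ} (ha : |a.re| < 1) (hb : |b.re| < 1) (t : ℝ) :
    kernel a t * conj (kernel b t) =
      (1 / 4) * (1 / (((t : ℂ) - I * (1 - a)) * ((t : ℂ) - -(I * (1 - conj b))))
        - 1 / (((t : ℂ) - I * (1 - a)) * ((t : ℂ) - I * (1 + conj b)))
        - 1 / (((t : ℂ) - -(I * (1 + a))) * ((t : ℂ) - -(I * (1 - conj b))))
        + 1 / (((t : ℂ) - -(I * (1 + a))) * ((t : ℂ) - I * (1 + conj b)))) := by
  have hb' : |(conj b).re| < 1 := by simpa using hb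
  have i1 : (I * (1 - a)).im ≠ 0 := by simp; linarith [(abs_lt.1 ha).2]
  have i2 : (-(I * (1 + a))).im ≠ 0 := by simp; linarith [(abs_lt.1 ha).1]
  have i3 : (-(I * (1 - conj b))).im ≠ 0 := by simp; linarith [(abs_lt.1 hb).2]
  have i4 : (I * (1 + conj b)).im ≠ 0 := by simp; linarith [(abs_lt.1 hb).1]
  have f1 := ofReal_sub_ne_zero i1 t
  have f2 := ofReal_sub_ne_zero i2 t
  have f3 := ofReal_sub_ne_zero i3 t
  have f4 := ofReal_sub_ne_zero i4 t
  have e1 : 1 - a + t * I = I * ((t : ℂ) - I * (1 - a)) := by ring_nf; rw [I_sq]; ring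
  have e2 : 1 + a - t * I = -I * ((t : ℂ) - -(I * (1 + a))) := by ring_nf; rw [I_sq]; ring
  have e3 : 1 - conj b + ((-t : ℝ) : ℂ) * I = -I * ((t : ℂ) - -(I * (1 - conj b))) := by
    push_cast; ring_nf; rw [I_sq]; ring
  have e4 : 1 + conj b - ((-t : ℝ) : ℂ) * I = I * ((t : ℂ) - I * (1 + conj b)) := by
    push_cast; ring_nf; rw [I_sq]; ring
  rw [conj_kernel, kernel_eq_half_add ha, kernel_eq_half_add hb', e1, e2, e3, e4]
  exact half_add_mul_half_add_eq f1 f2 f3 f4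

/-- The product of two kernels is integrable on `ℝ` (`|Re a|, |Re b| < 1`). [cite: BaluyotEtAl2024, Lemma 3 (proof, display (integral))] -/
theorem integrable_kernel_mul_conj_kernel {a b : ℂ} (ha : |a.re| < 1) (hb : |b.re| < 1) :
    Integrable fun t : ℝ ↦ kernel a t * conj (kernel b t) := by
  have i1 : (I * (1 - a)).im ≠ 0 := by simp; linarith [(abs_lt.1 ha).2]
  have i2 : (-(I * (1 + a))).im ≠ 0 := by simp; linarith [(abs_lt.1 ha).1]
  have i3 : (-(I * (1 - conj b))).im ≠ 0 := by simp; linarith [(abs_lt.1 hb).2]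
  have i4 : (I * (1 + conj b)).im ≠ 0 := by simp; linarith [(abs_lt.1 hb).1]
  have I1 := integrable_inv_sub_mul_inv_sub i1 i3
  have I2 := integrable_inv_sub_mul_inv_sub i1 i4
  have I3 := integrable_inv_sub_mul_inv_sub i2 i3
  have I4 := integrable_inv_sub_mul_inv_sub i2 i4
  refine ((((I1.sub I2).sub I3).add I4).const_mul (1 / 4)).congr (Eventually.of_forall fun t ↦ ?_)
  simp only [Pi.add_apply, Pi.sub_apply]
  rw [kernel_mul_conj_kernel_eq ha hb t]

/-- **The convolution identity** (BGST 2024, proof of Lemma 3, display (integral), in the two-kernel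
form): for `|Re a|, |Re b| < 1`,
`∫_ℝ K(a,t) conj(K(b,t)) dt = (π/2) w(a + b̄)`, `w(u) = 4/(4 − u²)`.
(The upper-half-plane residues: `2πi/(t₁−t₃) = 2π/(2−u)` and `2πi/(t₄−t₂) = 2π/(2+u)`,
`u = a + b̄`; the two same-half-plane terms vanish.) On the critical line (`a = iγ`, `b = iγ'`) this is
the tree's `Montgomery.integral_cauchyKernel_mul_cauchyKernel`.
[cite: BaluyotEtAl2024, Lemma 3 (proof, display (integral))] -/
theorem integral_kernel_mul_conj_kernel {a b : ℂ} (ha : |a.re| < 1) (hb : |b.re| < 1) :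
    ∫ t : ℝ, kernel a t * conj (kernel b t) = (π / 2 : ℂ) * weight (a + conj b) := by
  have ha1 := (abs_lt.1 ha).1; have ha2 := (abs_lt.1 ha).2
  have hb1 := (abs_lt.1 hb).1; have hb2 := (abs_lt.1 hb).2
  have i1 : 0 < (I * (1 - a)).im := by simp; linarith
  have i2 : (-(I * (1 + a))).im < 0 := by simp; linarith
  have i3 : (-(I * (1 - conj b))).im < 0 := by simp; linarith
  have i4 : 0 < (I * (1 + conj b)).im := by simp; linarith
  set f1 : ℝ → ℂ := fun t ↦ 1 / (((t : ℂ) - I * (1 - a)) * ((t : ℂ) - -(I * (1 - conj b)))) with hf1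
  set f2 : ℝ → ℂ := fun t ↦ 1 / (((t : ℂ) - I * (1 - a)) * ((t : ℂ) - I * (1 + conj b))) with hf2
  set f3 : ℝ → ℂ := fun t ↦ 1 / (((t : ℂ) - -(I * (1 + a))) * ((t : ℂ) - -(I * (1 - conj b))))
    with hf3
  set f4 : ℝ → ℂ := fun t ↦ 1 / (((t : ℂ) - -(I * (1 + a))) * ((t : ℂ) - I * (1 + conj b))) with hf4
  have I1 : Integrable f1 := integrable_inv_sub_mul_inv_sub i1.ne' i3.ne
  have I2 : Integrable f2 := integrable_inv_sub_mul_inv_sub i1.ne' i4.ne'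
  have I3 : Integrable f3 := integrable_inv_sub_mul_inv_sub i2.ne i3.ne
  have I4 : Integrable f4 := integrable_inv_sub_mul_inv_sub i2.ne i4.ne'
  have I12 : Integrable (fun t ↦ f1 t - f2 t) := I1.sub I2
  have I123 : Integrable (fun t ↦ f1 t - f2 t - f3 t) := I12.sub I3
  have J1 : ∫ t : ℝ, f1 t = 2 * π * I / (I * (1 - a) - -(I * (1 - conj b))) :=
    integral_inv_sub_mul_inv_sub_of_im_pos_of_im_neg i1 i3
  have J2 : ∫ t : ℝ, f2 t = 0 := integral_inv_sub_mul_inv_sub_of_im_pos i1 i4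
  have J3 : ∫ t : ℝ, f3 t = 0 := integral_inv_sub_mul_inv_sub_of_im_neg i2 i3
  have J4 : ∫ t : ℝ, f4 t = 2 * π * I / (I * (1 + conj b) - -(I * (1 + a))) :=
    integral_inv_sub_mul_inv_sub_of_im_neg_of_im_pos i2 i4
  have hform : ∀ t : ℝ, kernel a t * conj (kernel b t) = (1 / 4) * (f1 t - f2 t - f3 t + f4 t) := by
    intro t; rw [kernel_mul_conj_kernel_eq ha hb t]
  simp_rw [hform]
  rw [integral_const_mul, integral_add I123 I4, integral_sub I12 I3, integral_sub I1 I2, J1, J2, J3, J4]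
  -- `t₁ − t₃ = i(2 − u)`, `t₄ − t₂ = i(2 + u)`, `u = a + b̄`
  have hu1 : (2 : ℂ) - (a + conj b) ≠ 0 := by
    intro h; have := congrArg Complex.re h; simp at this; linarith
  have hu2 : (2 : ℂ) + (a + conj b) ≠ 0 := by
    intro h; have := congrArg Complex.re h; simp at this; linarith
  have e1 : I * (1 - a) - -(I * (1 - conj b)) = I * (2 - (a + conj b)) := by ring
  have e2 : I * (1 + conj b) - -(I * (1 + a)) = I * (2 + (a + conj b)) := by ring
  have hw : (4 : ℂ) - (a + conj b) ^ 2 ≠ 0 := by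
    have : (4 : ℂ) - (a + conj b) ^ 2 = (2 - (a + conj b)) * (2 + (a + conj b)) := by ring
    rw [this]; exact mul_ne_zero hu1 hu2
  rw [e1, e2, weight]
  have hI : (I : ℂ) ≠ 0 := I_ne_zero
  field_simp
  ring

/-! ## §3. Finite sums of kernels: the exact `L²` identity -/

/-- Pointwise bound for the kernel off the line: for `|Re a| ≤ 1/2`,
`‖K(a,t)‖ ≤ 4/(1 + (t − Im a)²)` (each linear factor has modulus `≥ √(1/4 + (t − Im a)²)`; the
source's "trivial estimate"). [cite: BaluyotEtAl2024, §2 (trivialestimate)] -/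
theorem norm_kernel_le {a : ℂ} (ha : |a.re| ≤ 1 / 2) (t : ℝ) :
    ‖kernel a t‖ ≤ 4 / (1 + (t - a.im) ^ 2) := by
  have ha1 := (abs_le.1 ha).1; have ha2 := (abs_le.1 ha).2
  set q : ℝ := 1 / 4 + (t - a.im) ^ 2 with hq_def
  have hq : 0 < q := by positivity
  have h1 : q ≤ ‖1 - a + t * I‖ ^ 2 := by
    rw [← Complex.normSq_eq_norm_sq, Complex.normSq_apply]
    simp
    nlinarith
  have h2 : q ≤ ‖1 + a - t * I‖ ^ 2 := by
    rw [← Complex.normSq_eq_norm_sq, Complex.normSq_apply]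
    simp
    nlinarith
  have hsq : q ^ 2 ≤ (‖1 - a + t * I‖ * ‖1 + a - t * I‖) ^ 2 := by
    rw [mul_pow, sq]
    exact mul_le_mul h1 h2 hq.le (by positivity)
  have hprod : q ≤ ‖1 - a + t * I‖ * ‖1 + a - t * I‖ :=
    (pow_le_pow_iff_left₀ hq.le (by positivity) two_ne_zero).1 hsq
  have hpos : 0 < ‖1 - a + t * I‖ * ‖1 + a - t * I‖ := hq.trans_le hprod
  rw [kernel, one_sub_sq_eq, norm_div, norm_one, norm_mul, div_le_div_iff₀ hpos (by positivity)]
  nlinarith [sq_nonneg (t - a.im)]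

/-- The kernel is continuous in `t` (`|Re a| < 1`). [cite: BaluyotEtAl2024, Lemma 3 (proof)] -/
theorem continuous_kernel {a : ℂ} (ha : |a.re| < 1) : Continuous fun t : ℝ ↦ kernel a t := by
  unfold kernel
  exact continuous_const.div (by fun_prop) fun t ↦ one_sub_sq_ne_zero ha t

/-- **The bilinear `L²` identity for finite kernel sums**: for finite sets `Z, Z'` of points with
`|Re ρ − 1/2| < 1` and coefficients `c, c'`,
`∫_ℝ (Σ_{ρ∈Z} c_ρ K(ρ−½,t)) · conj(Σ_{ρ'∈Z'} c'_{ρ'} K(ρ'−½,t)) dt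
 = (π/2) Σ_{ρ,ρ'} c_ρ conj(c'_{ρ'}) w(ρ + ρ̄' − 1)`
("multiplying out", BGST 2024, proof of Lemma 3). [cite: BaluyotEtAl2024, Lemma 3 (proof)] -/
theorem integral_sum_kernel_mul_conj_sum_kernel (Z Z' : Finset ℂ) (c c' : ℂ → ℂ)
    (hZ : ∀ ρ ∈ Z, |(ρ - 1 / 2).re| < 1) (hZ' : ∀ ρ ∈ Z', |(ρ - 1 / 2).re| < 1) :
    ∫ t : ℝ, (∑ ρ ∈ Z, c ρ * kernel (ρ - 1 / 2) t) *
        conj (∑ ρ' ∈ Z', c' ρ' * kernel (ρ' - 1 / 2) t) =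
      (π / 2 : ℂ) * ∑ ρ ∈ Z, ∑ ρ' ∈ Z', c ρ * conj (c' ρ') * weight (ρ + conj ρ' - 1) := by
  -- multiply out
  have hpt : ∀ t : ℝ, (∑ ρ ∈ Z, c ρ * kernel (ρ - 1 / 2) t) *
      conj (∑ ρ' ∈ Z', c' ρ' * kernel (ρ' - 1 / 2) t) =
      ∑ ρ ∈ Z, ∑ ρ' ∈ Z', c ρ * conj (c' ρ') *
        (kernel (ρ - 1 / 2) t * conj (kernel (ρ' - 1 / 2) t)) := by
    intro t
    rw [map_sum, Finset.sum_mul_sum]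
    refine Finset.sum_congr rfl fun ρ _ ↦ Finset.sum_congr rfl fun ρ' _ ↦ ?_
    rw [map_mul]
    ring
  simp_rw [hpt]
  -- integrate term by term
  have hint : ∀ ρ ∈ Z, ∀ ρ' ∈ Z', Integrable fun t : ℝ ↦ c ρ * conj (c' ρ') *
      (kernel (ρ - 1 / 2) t * conj (kernel (ρ' - 1 / 2) t)) :=
    fun ρ hρ ρ' hρ' ↦ (integrable_kernel_mul_conj_kernel (hZ ρ hρ) (hZ' ρ' hρ')).const_mul _
  rw [integral_finsetSum _ fun ρ hρ ↦ integrable_finsetSum _ fun ρ' hρ' ↦ hint ρ hρ ρ' hρ',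
    Finset.mul_sum]
  refine Finset.sum_congr rfl fun ρ hρ ↦ ?_
  rw [integral_finsetSum _ fun ρ' hρ' ↦ hint ρ hρ ρ' hρ', Finset.mul_sum]
  refine Finset.sum_congr rfl fun ρ' hρ' ↦ ?_
  rw [integral_const_mul, integral_kernel_mul_conj_kernel (hZ ρ hρ) (hZ' ρ' hρ')]
  have e : ρ - 1 / 2 + conj (ρ' - 1 / 2) = ρ + conj ρ' - 1 := by
    simp only [map_sub, map_div₀, map_one, map_ofNat]
    ring
  rw [e]
  ring

/-- **`S_Z(x,t) = Σ_{ρ∈Z} m(ρ) x^{ρ−1/2} K(ρ−½, t)`** — the kernel sum over a finite set `Z` of zeros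
of `ζ`, weighted by the multiplicities `m(ρ)` (`BGSTB2024.mult`); for `Z` = the zeros with
`0 < γ ≤ T` it is the inner sum of BGST 2024, Lemma 3 (lem3eq),
"`Σ_{ρ: 0<γ≤T} x^{ρ−1/2}/(1 − (ρ−(1/2+it))²)`" (zeros with multiplicity), and for the window
`T < γ ≤ 2T` the one of the 2025 correction. [cite: BaluyotEtAl2024, Lemma 3 (lem3eq)] -/
def zeroKernelSum (Z : Finset ℂ) (x t : ℝ) : ℂ :=
  ∑ ρ ∈ Z, (mult ρ : ℂ) * (x : ℂ) ^ (ρ - 1 / 2) * kernel (ρ - 1 / 2) t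

/-- For real `x > 0`: `conj(x^s) = x^{s̄}`. [folklore] -/
private theorem conj_ofReal_cpow {x : ℝ} (hx : 0 < x) (s : ℂ) : conj ((x : ℂ) ^ s) = (x : ℂ) ^ conj s := by
  have harg : (x : ℂ).arg ≠ π := by
    rw [Complex.arg_ofReal_of_nonneg hx.le]; exact Real.pi_ne_zero.symm
  have h := Complex.conj_cpow (x : ℂ) (conj s) harg
  rw [Complex.conj_conj, Complex.conj_ofReal] at h
  exact h.symm

/-- Multiplicities are invariant under the reflection `ρ ↦ 1 − ρ̄` of a non-trivial zero
(`riemannZetaZeroOrder_one_sub_conj`). [cite: BaluyotEtAl2024, §2 («1 − ρ̄ = 1/2 − δ + iγ» is again a zero)] -/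
theorem mult_one_sub_conj {ρ : ℂ} (hρ : ρ ∈ ZetaZeros.riemannZetaNontrivialZeros) :
    mult (1 - conj ρ) = mult ρ := by
  unfold mult
  rw [riemannZetaZeroOrder_one_sub_conj (ZetaZeros.riemannZetaNontrivialZeros.re_pos hρ)
    (ZetaZeros.riemannZetaNontrivialZeros.re_lt_one hρ)]

/-- A non-trivial zero has `|Re ρ − 1/2| < 1/2`. [cite: BaluyotEtAl2024, §2 («ρ = 1/2 + δ + iγ, −1/2 < δ < 1/2»)] -/
theorem abs_re_sub_half_lt {ρ : ℂ} (hρ : ρ ∈ ZetaZeros.riemannZetaNontrivialZeros) :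
    |(ρ - 1 / 2).re| < 1 / 2 := by
  have h0 := ZetaZeros.riemannZetaNontrivialZeros.re_pos hρ
  have h1 := ZetaZeros.riemannZetaNontrivialZeros.re_lt_one hρ
  rw [abs_lt]
  simp only [sub_re, one_re, div_ofNat_re]
  constructor <;> linarith

/-- **Lemma 3 for a finite reflection-closed set of zeros** (BGST 2024, proof of Lemma 3 with
(F(x,T)2)): if `Z` is a finite set of non-trivial zeros closed under `ρ ↦ 1 − ρ̄`, then for `x > 0`
`∫_ℝ S_Z(x,t) conj(S_Z(x,t)) dt = (π/2) Σ_{ρ,ρ'∈Z} m(ρ)m(ρ') x^{ρ−ρ'} w(ρ−ρ')`: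
multiply out, `x^{ρ−1/2} conj(x^{ρ'−1/2}) = x^{ρ+ρ̄'−1}`, and reindex `ρ' ↦ 1 − ρ̄'` (which fixes
`Z` and the multiplicities). [cite: BaluyotEtAl2024, Lemma 3 (proof) and (F(x,T)2)] -/
theorem integral_zeroKernelSum_mul_conj (Z : Finset ℂ)
    (hZ : ∀ ρ ∈ Z, ρ ∈ ZetaZeros.riemannZetaNontrivialZeros) (hsymm : ∀ ρ ∈ Z, 1 - conj ρ ∈ Z)
    {x : ℝ} (hx : 0 < x) :
    ∫ t : ℝ, zeroKernelSum Z x t * conj (zeroKernelSum Z x t) =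
      (π / 2 : ℂ) * ∑ ρ ∈ Z, ∑ ρ' ∈ Z,
        (mult ρ : ℂ) * (mult ρ' : ℂ) * ((x : ℂ) ^ (ρ - ρ') * weight (ρ - ρ')) := by
  have hx0 : (x : ℂ) ≠ 0 := ofReal_ne_zero.2 hx.ne'
  have hZ1 : ∀ ρ ∈ Z, |(ρ - 1 / 2).re| < 1 :=
    fun ρ hρ ↦ (abs_re_sub_half_lt (hZ ρ hρ)).trans (by norm_num)
  have h := integral_sum_kernel_mul_conj_sum_kernel Z Z
    (fun ρ ↦ (mult ρ : ℂ) * (x : ℂ) ^ (ρ - 1 / 2)) (fun ρ ↦ (mult ρ : ℂ) * (x : ℂ) ^ (ρ - 1 / 2)) hZ1 hZ1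
  unfold zeroKernelSum
  rw [h]
  congr 1
  refine Finset.sum_congr rfl fun ρ hρ ↦ ?_
  -- the inner sum, reindexed by `ρ' ↦ 1 - conj ρ'`
  refine Finset.sum_nbij' (fun ρ' ↦ 1 - conj ρ') (fun ρ' ↦ 1 - conj ρ') (fun ρ' hρ' ↦ hsymm ρ' hρ')
    (fun ρ' hρ' ↦ hsymm ρ' hρ') (fun ρ' _ ↦ by simp) (fun ρ' _ ↦ by simp) fun ρ' hρ' ↦ ?_
  rw [mult_one_sub_conj (hZ ρ' hρ'), map_mul, map_natCast, conj_ofReal_cpow hx]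
  have e1 : (x : ℂ) ^ (ρ - 1 / 2) * (x : ℂ) ^ conj (ρ' - 1 / 2) = (x : ℂ) ^ (ρ - (1 - conj ρ')) := by
    rw [← cpow_add _ _ hx0]
    congr 1
    simp only [map_sub, map_div₀, map_one, map_ofNat]
    ring
  have e2 : ρ + conj ρ' - 1 = ρ - (1 - conj ρ') := by ring
  rw [e2, ← e1]
  ring

/-- The same identity with the real mean square on the left:
`∫_ℝ ‖S_Z(x,t)‖² dt = (π/2) Σ_{ρ,ρ'∈Z} m(ρ)m(ρ') x^{ρ−ρ'} w(ρ−ρ')` (as complex numbers).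
[cite: BaluyotEtAl2024, Lemma 3] -/
theorem integral_norm_zeroKernelSum_sq (Z : Finset ℂ)
    (hZ : ∀ ρ ∈ Z, ρ ∈ ZetaZeros.riemannZetaNontrivialZeros) (hsymm : ∀ ρ ∈ Z, 1 - conj ρ ∈ Z)
    {x : ℝ} (hx : 0 < x) :
    ((∫ t : ℝ, ‖zeroKernelSum Z x t‖ ^ 2 : ℝ) : ℂ) =
      (π / 2 : ℂ) * ∑ ρ ∈ Z, ∑ ρ' ∈ Z,
        (mult ρ : ℂ) * (mult ρ' : ℂ) * ((x : ℂ) ^ (ρ - ρ') * weight (ρ - ρ')) := by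
  rw [← integral_zeroKernelSum_mul_conj Z hZ hsymm hx, ← integral_complex_ofReal]
  congr 1
  funext t
  push_cast
  exact (Complex.mul_conj' _).symm

/-- The window sum is continuous in `t`. [cite: BaluyotEtAl2024, Lemma 3 (lem3eq)] -/
theorem continuous_zeroKernelSum (Z : Finset ℂ)
    (hZ : ∀ ρ ∈ Z, ρ ∈ ZetaZeros.riemannZetaNontrivialZeros) (x : ℝ) :
    Continuous fun t : ℝ ↦ zeroKernelSum Z x t := by
  unfold zeroKernelSum
  refine continuous_finsetSum _ fun ρ hρ ↦ ?_
  exact continuous_const.mul (continuous_kernel ((abs_re_sub_half_lt (hZ ρ hρ)).trans (by norm_num)))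

/-- `‖S_Z(x,·)‖²` is integrable on `ℝ`. [cite: BaluyotEtAl2024, Lemma 3 (lem3eq)] -/
theorem integrable_norm_zeroKernelSum_sq (Z : Finset ℂ)
    (hZ : ∀ ρ ∈ Z, ρ ∈ ZetaZeros.riemannZetaNontrivialZeros) (x : ℝ) :
    Integrable fun t : ℝ ↦ ‖zeroKernelSum Z x t‖ ^ 2 := by
  have hZ1 : ∀ ρ ∈ Z, |(ρ - 1 / 2).re| < 1 :=
    fun ρ hρ ↦ (abs_re_sub_half_lt (hZ ρ hρ)).trans (by norm_num)
  -- `S conj S` is a finite sum of integrable terms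
  have hprod : Integrable fun t : ℝ ↦ zeroKernelSum Z x t * conj (zeroKernelSum Z x t) := by
    have hpt : ∀ t : ℝ, zeroKernelSum Z x t * conj (zeroKernelSum Z x t) =
        ∑ ρ ∈ Z, ∑ ρ' ∈ Z, ((mult ρ : ℂ) * (x : ℂ) ^ (ρ - 1 / 2)) *
          conj ((mult ρ' : ℂ) * (x : ℂ) ^ (ρ' - 1 / 2)) *
          (kernel (ρ - 1 / 2) t * conj (kernel (ρ' - 1 / 2) t)) := by
      intro t
      unfold zeroKernelSum
      rw [map_sum, Finset.sum_mul_sum]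
      refine Finset.sum_congr rfl fun ρ _ ↦ Finset.sum_congr rfl fun ρ' _ ↦ ?_
      simp only [map_mul]
      ring
    simp_rw [hpt]
    refine integrable_finsetSum _ fun ρ hρ ↦ integrable_finsetSum _ fun ρ' hρ' ↦ ?_
    exact (integrable_kernel_mul_conj_kernel (hZ1 ρ hρ) (hZ1 ρ' hρ')).const_mul _
  have h := hprod.re
  refine h.congr (Eventually.of_forall fun t ↦ ?_)
  simp only [RCLike.re_to_complex]
  rw [Complex.mul_conj']
  norm_cast

/-! ## §4. Lemma 3 and its dyadic twin -/

/-- The zeros of the box `0 < γ ≤ T` are non-trivial zeros. [cite: BaluyotEtAl2024, §1 («ρ = β + iγ … a zero satisfying β > 0»)] -/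
theorem mem_nontrivialZeros_of_mem_zerosUpTo {T : ℝ} {ρ : ℂ} (hρ : ρ ∈ zerosUpTo T) :
    ρ ∈ ZetaZeros.riemannZetaNontrivialZeros := by
  rw [mem_zerosUpTo] at hρ
  exact ZetaZeros.riemannZetaNontrivialZeros.mem_of_im_ne_zero hρ.1 hρ.2.2.2.1.ne'

/-- The box `0 < γ ≤ T` is closed under the reflection `ρ ↦ 1 − ρ̄` (which fixes ordinates).
[cite: BaluyotEtAl2024, §2 ("if ρ is a zero … 1 − ρ̄ = 1/2 − δ + iγ")] -/
theorem one_sub_conj_mem_zerosUpTo {T : ℝ} {ρ : ℂ} (hρ : ρ ∈ zerosUpTo T) :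
    1 - conj ρ ∈ zerosUpTo T := by
  have hnt := mem_nontrivialZeros_of_mem_zerosUpTo hρ
  have h' := ZetaZeros.riemannZetaNontrivialZeros.one_sub_conj_mem hnt
  rw [mem_zerosUpTo] at hρ ⊢
  obtain ⟨-, h0, h1, him, hT⟩ := hρ
  refine ⟨ZetaZeros.riemannZetaNontrivialZeros.zeta_eq_zero h', ?_, ?_, ?_, ?_⟩
  · simp only [sub_re, one_re, conj_re]; linarith
  · simp only [sub_re, one_re, conj_re]; linarith
  · simpa using him
  · simpa using hT

/-- The zeros of the dyadic window `T < γ ≤ 2T` are non-trivial zeros. [cite: BaluyotEtAl2025, §2 (calF)] -/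
theorem mem_nontrivialZeros_of_mem_zerosIn {T : ℝ} {ρ : ℂ} (hρ : ρ ∈ zerosIn T) :
    ρ ∈ ZetaZeros.riemannZetaNontrivialZeros :=
  mem_nontrivialZeros_of_mem_zerosUpTo (zerosIn_subset T hρ)

/-- The dyadic window `T < γ ≤ 2T` is closed under `ρ ↦ 1 − ρ̄`.
[cite: BaluyotEtAl2025, §2 (calF)] -/
theorem one_sub_conj_mem_zerosIn {T : ℝ} {ρ : ℂ} (hρ : ρ ∈ zerosIn T) : 1 - conj ρ ∈ zerosIn T := by
  rw [mem_zerosIn] at hρ ⊢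
  refine ⟨?_, by simpa using hρ.2⟩
  have := one_sub_conj_mem_zerosUpTo (T := 2 * T) (ρ := ρ) (by rw [mem_zerosUpTo]; exact hρ.1)
  rwa [mem_zerosUpTo] at this

/-- **BGST 2024, Lemma 3** (unconditional; zeros with multiplicity): for every `x > 0` and every
`T`, `F(x,T) = (2/π) ∫_ℝ |Σ_{ρ: 0<γ≤T} m(ρ) x^{ρ−1/2}/(1 − (ρ − (1/2+it))²)|² dt` — in particular
`F(x,T)` is real and non-negative. ("We have, for `x > 0` and `T ≥ 3`, `F(x,T) = (2/π)∫|Σ…|² dt`";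
the restriction `T ≥ 3` is not needed.) [cite: BaluyotEtAl2024, Lemma 3] -/
theorem _root_.Literature.NumberTheory.LFunctions.baluyotEtAl2024_lemma3 {x : ℝ} (hx : 0 < x)
    (T : ℝ) :
    pairSum x T = (2 / π : ℂ) * ((∫ t : ℝ, ‖zeroKernelSum (zerosUpTo T) x t‖ ^ 2 : ℝ) : ℂ) := by
  rw [integral_norm_zeroKernelSum_sq (zerosUpTo T) (fun ρ hρ ↦ mem_nontrivialZeros_of_mem_zerosUpTo hρ)
    (fun ρ hρ ↦ one_sub_conj_mem_zerosUpTo hρ) hx]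
  have hπ : (π : ℂ) ≠ 0 := ofReal_ne_zero.2 Real.pi_ne_zero
  rw [← mul_assoc, show (2 / π : ℂ) * (π / 2) = 1 by field_simp, one_mul]
  rfl

/-- **The dyadic pair sum as a mean square** (BGST 2025 §2 window): for every `x > 0` and every `T`,
`𝓕(x,T) = (2/π) ∫_ℝ |Σ_{ρ: T<γ≤2T} m(ρ) x^{ρ−1/2} K(ρ−½,t)|² dt`.
[cite: BaluyotEtAl2024, Lemma 3] -/
theorem pairSumDyadic_eq_integral {x : ℝ} (hx : 0 < x) (T : ℝ) :
    pairSumDyadic x T = (2 / π : ℂ) * ((∫ t : ℝ, ‖zeroKernelSum (zerosIn T) x t‖ ^ 2 : ℝ) : ℂ) := by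
  rw [integral_norm_zeroKernelSum_sq (zerosIn T) (fun ρ hρ ↦ mem_nontrivialZeros_of_mem_zerosIn hρ)
    (fun ρ hρ ↦ one_sub_conj_mem_zerosIn hρ) hx]
  have hπ : (π : ℂ) ≠ 0 := ofReal_ne_zero.2 Real.pi_ne_zero
  rw [← mul_assoc, show (2 / π : ℂ) * (π / 2) = 1 by field_simp, one_mul]
  rfl

/-- Mean-square form of Lemma 3, solved for the integral:
`∫_ℝ ‖S_{(0,T]}(x,t)‖² dt = (π/2)·Re F(x,T)`. [cite: BaluyotEtAl2024, Lemma 3] -/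
theorem integral_norm_zeroKernelSum_zerosUpTo_sq {x : ℝ} (hx : 0 < x) (T : ℝ) :
    ∫ t : ℝ, ‖zeroKernelSum (zerosUpTo T) x t‖ ^ 2 = π / 2 * (pairSum x T).re := by
  have h := congrArg Complex.re (baluyotEtAl2024_lemma3 hx T)
  rw [show (2 / π : ℂ) = ((2 / π : ℝ) : ℂ) by push_cast; rfl, re_ofReal_mul, ofReal_re] at h
  rw [h]
  field_simp

/-- Mean-square form for the dyadic window:
`∫_ℝ ‖S_{(T,2T]}(x,t)‖² dt = (π/2)·Re 𝓕(x,T)`. [cite: BaluyotEtAl2024, Lemma 3] -/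
theorem integral_norm_zeroKernelSum_zerosIn_sq {x : ℝ} (hx : 0 < x) (T : ℝ) :
    ∫ t : ℝ, ‖zeroKernelSum (zerosIn T) x t‖ ^ 2 = π / 2 * (pairSumDyadic x T).re := by
  have h := congrArg Complex.re (pairSumDyadic_eq_integral hx T)
  rw [show (2 / π : ℂ) = ((2 / π : ℝ) : ℂ) by push_cast; rfl, re_ofReal_mul, ofReal_re] at h
  rw [h]
  field_simp

/-! ## §5. The qualitative clauses of the unconditional Montgomery theorem, proved -/

/-- `F(x,T)` is real (every `x > 0`, every `T`). [cite: BaluyotEtAl2024, Theorem 1 ("F(α) is real")] -/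
theorem pairSum_im {x : ℝ} (hx : 0 < x) (T : ℝ) : (pairSum x T).im = 0 := by
  rw [baluyotEtAl2024_lemma3 hx T, show (2 / π : ℂ) = ((2 / π : ℝ) : ℂ) by push_cast; rfl,
    ← ofReal_mul, ofReal_im]

/-- `F(x,T) ≥ 0` (every `x > 0`, every `T`).
[cite: BaluyotEtAl2024, Theorem 1 ("F(α) is … nonnegative")] -/
theorem pairSum_re_nonneg {x : ℝ} (hx : 0 < x) (T : ℝ) : 0 ≤ (pairSum x T).re := by
  rw [baluyotEtAl2024_lemma3 hx T, show (2 / π : ℂ) = ((2 / π : ℝ) : ℂ) by push_cast; rfl,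
    ← ofReal_mul, ofReal_re]
  exact mul_nonneg (by positivity) (integral_nonneg fun t ↦ by positivity)

/-- `F(1/x,T) = F(x,T)` ("since `w(u)` is even, we see from (F(x,T)) that `F(1/x,T) = F(x,T)`":
swap `ρ ↔ ρ'`). [cite: BaluyotEtAl2024, §2 (proof of Theorem 1)] -/
theorem pairSum_inv {x : ℝ} (hx : 0 < x) (T : ℝ) : pairSum (1 / x) T = pairSum x T := by
  have harg : (x : ℂ).arg ≠ π := by
    rw [Complex.arg_ofReal_of_nonneg hx.le]; exact Real.pi_ne_zero.symm
  unfold pairSum pairSumWith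
  rw [Finset.sum_comm]
  refine Finset.sum_congr rfl fun ρ' _ ↦ Finset.sum_congr rfl fun ρ _ ↦ ?_
  have e1 : (((1 / x : ℝ)) : ℂ) ^ (ρ - ρ') = (x : ℂ) ^ (ρ' - ρ) := by
    rw [show (((1 / x : ℝ)) : ℂ) = (x : ℂ)⁻¹ by push_cast; ring, Complex.inv_cpow _ _ harg,
      ← Complex.cpow_neg, neg_sub]
  have e2 : weight (ρ - ρ') = weight (ρ' - ρ) := by
    unfold weight; ring
  dsimp only
  rw [e1, e2]
  ring

/-- `𝓕(x,T)` (dyadic window) is real (every `x > 0`, every `T`).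
[cite: BaluyotEtAl2025, §2 (MT) ("𝓕(x,T) ≥ 0")] -/
theorem pairSumDyadic_im {x : ℝ} (hx : 0 < x) (T : ℝ) : (pairSumDyadic x T).im = 0 := by
  rw [pairSumDyadic_eq_integral hx T, show (2 / π : ℂ) = ((2 / π : ℝ) : ℂ) by push_cast; rfl,
    ← ofReal_mul, ofReal_im]

/-- `𝓕(x,T) ≥ 0` (dyadic window; every `x > 0`, every `T`).
[cite: BaluyotEtAl2025, §2 (MT) ("𝓕(x,T) ≥ 0")] -/
theorem pairSumDyadic_re_nonneg {x : ℝ} (hx : 0 < x) (T : ℝ) : 0 ≤ (pairSumDyadic x T).re := by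
  rw [pairSumDyadic_eq_integral hx T, show (2 / π : ℂ) = ((2 / π : ℝ) : ℂ) by push_cast; rfl,
    ← ofReal_mul, ofReal_re]
  exact mul_nonneg (by positivity) (integral_nonneg fun t ↦ by positivity)

/-- `𝓕(1/x,T) = 𝓕(x,T)` (dyadic window; swap `ρ ↔ ρ'`, `W` even).
[cite: BaluyotEtAl2025, §2 (MT) ("𝓕(x,T) = 𝓕(1/x,T)")] -/
theorem pairSumDyadic_inv {x : ℝ} (hx : 0 < x) (T : ℝ) : pairSumDyadic (1 / x) T = pairSumDyadic x T := by
  have harg : (x : ℂ).arg ≠ π := by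
    rw [Complex.arg_ofReal_of_nonneg hx.le]; exact Real.pi_ne_zero.symm
  unfold pairSumDyadic
  rw [Finset.sum_comm]
  refine Finset.sum_congr rfl fun ρ' _ ↦ Finset.sum_congr rfl fun ρ _ ↦ ?_
  have e1 : (((1 / x : ℝ)) : ℂ) ^ (ρ - ρ') = (x : ℂ) ^ (ρ' - ρ) := by
    rw [show (((1 / x : ℝ)) : ℂ) = (x : ℂ)⁻¹ by push_cast; ring, Complex.inv_cpow _ _ harg,
      ← Complex.cpow_neg, neg_sub]
  have e2 : weight (ρ - ρ') = weight (ρ' - ρ) := by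
    unfold weight; ring
  rw [e1, e2]
  ring

/-- **The qualitative clauses of the unconditional Montgomery theorem (MT), PROVED** — the first
conjunct of `Literature.NumberTheory.LFunctions.baluyotEtAl2025_montgomeryTheorem` verbatim
(BGSTB 2025, §2 (MT): "For `x ≥ 1` and `T ≥ 3`, we have `𝓕(x,T) ≥ 0`, `𝓕(x,T) = 𝓕(1/x,T)`";
rendered there as: real, non-negative real part, and the symmetry). By Lemma 3 for the dyadic window
(`pairSumDyadic_eq_integral`); the asymptotic clause is the business of the sibling proof files.
[cite: BaluyotEtAl2025, §2 (MT)] -/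
theorem _root_.Literature.NumberTheory.LFunctions.baluyotEtAl2025_montgomeryTheorem_qualitative :
    ∀ x T : ℝ, 1 ≤ x → 3 ≤ T →
      (pairSumDyadic x T).im = 0 ∧ 0 ≤ (pairSumDyadic x T).re ∧
        pairSumDyadic (1 / x) T = pairSumDyadic x T := by
  intro x T hx _
  have hx0 : 0 < x := one_pos.trans_le hx
  exact ⟨pairSumDyadic_im hx0 T, pairSumDyadic_re_nonneg hx0 T, pairSumDyadic_inv hx0 T⟩

/-- **BGST 2024, Theorem 1, qualitative clauses, PROVED**: "The function `F(α)` is real, even, and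
nonnegative" (`F(α) = ((T/2π) log T)⁻¹ F(T^α, T)`, `T ≥ 3`) — the first conjunct of the 2024
Theorem 1 as typed in `UnconditionalPairCorrelation.lean` (that named fact is deprecated only for its
retracted error term; its qualitative part is this theorem). From Lemma 3 and `F(1/x,T) = F(x,T)`.
[cite: BaluyotEtAl2024, Theorem 1] -/
theorem _root_.Literature.NumberTheory.LFunctions.baluyotEtAl2024_theorem1_qualitative :
    ∀ α T : ℝ, 3 ≤ T →
      (formFactor α T).im = 0 ∧ formFactor (-α) T = formFactor α T ∧ 0 ≤ (formFactor α T).re := by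
  intro α T hT
  have hT0 : 0 < T := by linarith
  have hx0 : 0 < T ^ α := Real.rpow_pos_of_pos hT0 α
  have hlog : 0 ≤ Real.log T := Real.log_nonneg (by linarith)
  have hc : 0 ≤ (T / (2 * Real.pi) * Real.log T)⁻¹ := by positivity
  have hinv : ((T / (2 * Real.pi) * Real.log T : ℝ) : ℂ)⁻¹ =
      (((T / (2 * Real.pi) * Real.log T)⁻¹ : ℝ) : ℂ) := by push_cast; rfl
  refine ⟨?_, ?_, ?_⟩
  · rw [formFactor, hinv, im_ofReal_mul, pairSum_im hx0, mul_zero]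
  · rw [formFactor, formFactor, Real.rpow_neg hT0.le, inv_eq_one_div (T ^ α), pairSum_inv hx0]
  · rw [formFactor, hinv, re_ofReal_mul]
    exact mul_nonneg hc (pairSum_re_nonneg hx0 T)

end BGSTB2024

end Literature.NumberTheory.LFunctions

end
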